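import Literature.NumberTheory.Automorphic.HaarIntegralClosedCompactProofs
import Literature.MeasureTheory.Group.BruhatFunction
import HarnessLib

/-!
# Integration over `G ⧸ A` in Iwasawa coordinates `G = K N A`:
# `∫_{G ⧸ A} u = C ∫_K ∫_N u(k n A) dn dk`
(Gelbart, *Automorphic forms on adele groups* (1975), Remark 9.23 and Thm. 9.22 (iii): the
hyperbolic orbital integrals `∫_{A_v \ G_v} f_v(g⁻¹ μ g) dg = ∫_{N_v} ∫_{K_v} f_v(k⁻¹ n⁻¹ μ n k) dn dk`
"since `G = A N K` and `dg = da dn dk`"; Folland (1995), §2.6 for the measure theory)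

Topic `NumberTheory/Automorphic` (next to `HaarIntegralClosedCompactProofs`, whose `G = H K`
formula it extends); one definition with body (`anMap`, the coordinate map `A × N → B`) and
theorems; no named fact, no instance visible to importers.

Abstract setting: a second countable locally compact Hausdorff group `G` with an inversion
invariant (i.e. unimodular) Haar measure `ν`; subgroups `K` (compact), `N`, `A` and `B` (closed)
with `A`, `N ≤ B`, `A` normalising `N`, a homeomorphism `A × N ≃ₜ B`, `(a, n) ↦ a n` (so `B = A N`
topologically, e.g. a Borel subgroup `B = A ⋉ N`), and `G = K B` (Iwasawa decomposition); left
Haar measures `α` on `A` and `μ_N` on `N`, both inversion invariant (e.g. `A`, `N` abelian), a Haar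
measure `κ` on `K`, and a non-zero `G`-invariant measure `μ` on `G ⧸ A` finite on compact sets.

* `anMap`, `isMulLeftInvariant_map_anMap`, `isHaarMeasure_map_anMap` — **`α ⊗ μ_N` is a left
  Haar measure of `B = A N` in the coordinates `b = a n`** (`b₀ b = (a₀ a)((a⁻¹ n₀ a) n)` is a skew
  product of left translations, Mathlib `MeasurePreserving.skew_product`).
* `exists_lintegral_eq_mul_lintegral_KNA` — **`∫⁻_G F dν = c ∫⁻_K ∫⁻_N ∫⁻_A F(k n a) dα dμ_N dκ`** for
  measurable `F ≥ 0` (`HaarHK.eq_smul_map_prod` for `G = B K`, the coordinates on `B`, inversion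
  invariance of `ν`, `κ`, `μ_N`, `α` to pass from `a n k` to `k n a`, Tonelli).
* `exists_lintegral_quotient_eq_mul_lintegral_lintegral` — **`∫⁻_{G ⧸ A} u dμ =
  C ∫⁻_K ∫⁻_N u(k n A) dμ_N dκ`** for every measurable `u ≥ 0`, with one constant `C ≠ 0`
  (a Bruhat function `β` for `A`, `∫_{G/A} u = c' ∫_G β · (u ∘ π) dν`, the `K N A` formula and
  `∫_A β(g a) dα = 1`); `exists_measure_quotient_eq_smul_map` — the measure form
  `μ = C • (k, n) ↦ k n A)_* (κ ⊗ μ_N)`.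
* `integral_quotient_eq_smul_integral_prod`, `integral_quotient_eq_zero_of_forall_integral_eq_zero`
  — the Bochner form `∫_{G/A} φ dμ = C ∫_{K × N} φ(k n A) d(κ ⊗ μ_N)` for a.e.-strongly measurable
  `φ`, and **the vanishing principle: if `∫_N φ(k n A) dμ_N = 0` for every `k ∈ K` then
  `∫_{G ⧸ A} φ dμ = 0`** (Fubini when `φ(k n A)` is integrable on `K × N`, and `∫ = 0` by convention
  otherwise) — the form in which Gelbart's "`F^A_{f_v}(μ) = ∫_{N_v} ∫_{K_v} f_v(k⁻¹ n⁻¹ μ n k) dn dk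
  = 0`" (Remark 9.23) kills the hyperbolic orbital integrals of supercusp forms
  (`SupercuspFormHyperbolicIntegral` supplies the inner vanishing for `G = GL₂(F)`).

Part of the inline (D-0026) decomposition of
`Literature.NumberTheory.Automorphic.strong_multiplicity_one_quaternionUnits` (Gelbart Thm. 10.5:
(10.22), the vanishing of the `GL₂` elliptic terms at the places where the torus splits).

## References

* S. Gelbart, *Automorphic forms on adele groups*, Ann. of Math. Studies 83 (1975), Thm. 9.22 (iii),
  Remark 9.23, (10.22) [Gelbart1975].
* G. B. Folland, *A Course in Abstract Harmonic Analysis* (1995), §2.6, Prop. 2.48, Thm. 2.49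
  [Folland1995].
-/

noncomputable section

open MeasureTheory MeasureTheory.Measure Topology Filter
open scoped NNReal ENNReal

namespace Literature.NumberTheory.Automorphic

open Literature.MeasureTheory.Group

-- the coset spaces carry Borel σ-algebras supplied locally, not the quotient σ-algebra
attribute [-instance] Quotient.instMeasurableSpace QuotientGroup.measurableSpace

universe u

/-! ### `B = A N`: the left Haar measure in coordinates -/

section Borel

variable {G : Type u} [Group G] (A N B : Subgroup G) (hAB : A ≤ B) (hNB : N ≤ B)

/-- The coordinate map `A × N → B`, `(a, n) ↦ a n`. [folklore] -/
def anMap (p : A × N) : B := ⟨(p.1 : G) * (p.2 : G), B.mul_mem (hAB p.1.2) (hNB p.2.2)⟩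

/-- `anMap (a, n) = a n` in `G` (definitional). [folklore] -/
@[simp]
theorem coe_anMap (p : A × N) : (anMap A N B hAB hNB p : G) = (p.1 : G) * (p.2 : G) := rfl

variable {A N} (hAN : ∀ a ∈ A, ∀ n ∈ N, a * n * a⁻¹ ∈ N)

include hAN in
/-- Conjugation by `a⁻¹` also preserves `N`. [folklore] -/
theorem inv_mul_mul_mem (a : A) (n : N) : (a : G)⁻¹ * n * a ∈ N := by
  simpa using hAN _ (A.inv_mem a.2) n n.2

/-- **Left translations of `B` in coordinates**: `(a₀ n₀)(a n) = (a₀ a) ((a⁻¹ n₀ a) n)`, i.e.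
`b₀ · anMap (a, n) = anMap (a₀ a, c(a) n)` with `c(a) = a⁻¹ n₀ a ∈ N`. [folklore] -/
theorem mul_anMap (a₀ : A) (n₀ : N) (p : A × N) :
    anMap A N B hAB hNB (a₀, n₀) * anMap A N B hAB hNB p =
      anMap A N B hAB hNB (a₀ * p.1, ⟨(p.1 : G)⁻¹ * n₀ * p.1, inv_mul_mul_mem hAN p.1 n₀⟩ * p.2) := by
  apply Subtype.ext
  simp only [coe_anMap, Subgroup.coe_mul]
  group

/-- `G = K B` gives `G = B K` by inversion. [folklore] -/
theorem forall_exists_mem_mul_of_KB {K : Subgroup G} (hKB : ∀ g : G, ∃ k ∈ K, ∃ b ∈ B, g = k * b) :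
    ∀ g : G, ∃ b ∈ B, ∃ k ∈ K, g = b * k := by
  intro g
  obtain ⟨k, hk, b, hb, hg⟩ := hKB g⁻¹
  refine ⟨b⁻¹, B.inv_mem hb, k⁻¹, K.inv_mem hk, ?_⟩
  rw [← mul_inv_rev, ← hg, inv_inv]

variable (A N) [TopologicalSpace G] [IsTopologicalGroup G]

/-- `anMap` is continuous. [folklore] -/
theorem continuous_anMap : Continuous (anMap A N B hAB hNB) :=
  ((continuous_subtype_val.comp continuous_fst).mul (continuous_subtype_val.comp continuous_snd)).subtype_mk _

variable {A N} [SecondCountableTopology G] [MeasurableSpace G] [BorelSpace G]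
  (α : Measure A) [IsHaarMeasure α] [SFinite α] (μN : Measure N) [IsHaarMeasure μN] [SFinite μN]

include hAN in
/-- **`(anMap)_* (α ⊗ μ_N)` is left invariant on `B`**: left translation by `b₀ = a₀ n₀` is, in
coordinates, the skew product `(a, n) ↦ (a₀ a, (a⁻¹ n₀ a) n)` of left translations, which preserves
`α ⊗ μ_N` (`MeasurePreserving.skew_product`). [cite: Folland1995, §2.6] -/
theorem isMulLeftInvariant_map_anMap (e : A × N ≃ₜ B) (he : ∀ p, e p = anMap A N B hAB hNB p) :
    (Measure.map (anMap A N B hAB hNB) (α.prod μN)).IsMulLeftInvariant := by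
  haveI : BorelSpace A := Subtype.borelSpace _
  haveI : BorelSpace N := Subtype.borelSpace _
  haveI : BorelSpace B := Subtype.borelSpace _
  haveI : SecondCountableTopology A := TopologicalSpace.Subtype.secondCountableTopology _
  haveI : SecondCountableTopology N := TopologicalSpace.Subtype.secondCountableTopology _
  haveI : BorelSpace (A × N) := Prod.borelSpace
  have hm : Measurable (anMap A N B hAB hNB) := (continuous_anMap A N B hAB hNB).measurable
  refine ⟨fun b₀ => ?_⟩
  obtain ⟨⟨a₀, n₀⟩, rfl⟩ := e.surjective b₀
  rw [he]
  -- the skew product `T (a, n) = (a₀ a, c(a) n)`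
  set T : A × N → A × N := fun p => (a₀ * p.1, ⟨(p.1 : G)⁻¹ * n₀ * p.1, inv_mul_mul_mem hAN p.1 n₀⟩ * p.2)
    with hT
  have hgc : Continuous fun p : A × N => (⟨(p.1 : G)⁻¹ * n₀ * p.1, inv_mul_mul_mem hAN p.1 n₀⟩ : N) * p.2 :=
    ((((continuous_subtype_val.comp continuous_fst).inv.mul continuous_const).mul
      (continuous_subtype_val.comp continuous_fst)).subtype_mk _).mul continuous_snd
  have hTm : MeasurePreserving T (α.prod μN) (α.prod μN) :=
    (measurePreserving_mul_left α a₀).skew_product (g := fun a n =>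
      (⟨(a : G)⁻¹ * n₀ * a, inv_mul_mul_mem hAN a n₀⟩ : N) * n) hgc.measurable
      (Eventually.of_forall fun a => (measurePreserving_mul_left μN _).map_eq)
  have hcomp : (fun b : B => anMap A N B hAB hNB (a₀, n₀) * b) ∘ anMap A N B hAB hNB =
      anMap A N B hAB hNB ∘ T := by
    funext p
    exact mul_anMap B hAB hNB hAN a₀ n₀ p
  rw [Measure.map_map (measurable_const_mul _) hm, hcomp, ← Measure.map_map hm hTm.measurable, hTm.map_eq]

include hAN in
/-- **`(anMap)_* (α ⊗ μ_N)` is a left Haar measure on `B = A N`** when `A × N → B` is a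
homeomorphism and `α`, `μ_N` are left Haar measures (left invariant: `isMulLeftInvariant_map_anMap`;
finite on compact sets and positive on open sets: transport along the homeomorphism). In
coordinates `b = a n`: `d_ℓ b = dα(a) dμ_N(n)` (Folland (1995), §2.6; for `GL₂`:
`dg = y⁻¹ dx d×y₁ d×y₂ dk` in `g = n(x) diag(y₁, y₂) k` becomes `d×y₁ d×y₂ dx` in `b = diag · n`).
[cite: Folland1995, §2.6] -/
theorem isHaarMeasure_map_anMap [LocallyCompactSpace G] (e : A × N ≃ₜ B)
    (he : ∀ p, e p = anMap A N B hAB hNB p) :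
    IsHaarMeasure (Measure.map (anMap A N B hAB hNB) (α.prod μN)) := by
  haveI : BorelSpace A := Subtype.borelSpace _
  haveI : BorelSpace N := Subtype.borelSpace _
  haveI : BorelSpace B := Subtype.borelSpace _
  haveI : SecondCountableTopology A := TopologicalSpace.Subtype.secondCountableTopology _
  haveI : SecondCountableTopology N := TopologicalSpace.Subtype.secondCountableTopology _
  haveI : BorelSpace (A × N) := Prod.borelSpace
  have hcoe : (anMap A N B hAB hNB : A × N → B) = e := funext fun p => (he p).symm
  haveI := isMulLeftInvariant_map_anMap B hAB hNB hAN α μN e he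
  haveI : IsFiniteMeasureOnCompacts (Measure.map (anMap A N B hAB hNB) (α.prod μN)) := by
    rw [hcoe]
    exact IsFiniteMeasureOnCompacts.map _ e
  haveI : (Measure.map (anMap A N B hAB hNB) (α.prod μN)).IsOpenPosMeasure := by
    rw [hcoe]
    exact e.continuous.isOpenPosMeasure_map e.surjective
  exact {}

end Borel

/-! ### `∫_G F dν = c ∫_K ∫_N ∫_A F(k n a)` -/

section KNA

variable {G : Type u} [Group G] [TopologicalSpace G] [IsTopologicalGroup G] [LocallyCompactSpace G]
  [T2Space G] [SecondCountableTopology G] [MeasurableSpace G] [BorelSpace G]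
  {K A N B : Subgroup G} (hK : IsCompact (K : Set G)) (hB : IsClosed (B : Set G))
  (hAB : A ≤ B) (hNB : N ≤ B) (hAN : ∀ a ∈ A, ∀ n ∈ N, a * n * a⁻¹ ∈ N)
  (e : A × N ≃ₜ B) (he : ∀ p, e p = anMap A N B hAB hNB p)
  (hKB : ∀ g : G, ∃ k ∈ K, ∃ b ∈ B, g = k * b)
  (ν : Measure G) [IsHaarMeasure ν] [ν.IsInvInvariant]
  (κ : Measure K) [IsHaarMeasure κ] [SFinite κ]
  (α : Measure A) [IsHaarMeasure α] [α.IsInvInvariant] [SFinite α]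
  (μN : Measure N) [IsHaarMeasure μN] [μN.IsInvInvariant] [SFinite μN]

include hK hB hAN e he hKB in
/-- **`∫⁻_G F dν = c ∫⁻_K ∫⁻_N ∫⁻_A F(k n a) dα dμ_N dκ`** for every measurable `F : G → [0, ∞]`, with
one constant `c ≠ 0` (`HaarHK.decompConst` for `G = B K` and the left Haar measure
`(anMap)_* (α ⊗ μ_N)` of `B`):
`∫_G F = c ∫_B ∫_K F(b k⁻¹)` (`HaarHK.eq_smul_map_prod`), `= c ∫_A ∫_N ∫_K F(a n k)` (coordinates on
`B`, `κ` inversion invariant), and `F ↦ F ∘ inv` with the inversion invariance of `ν`, `κ`, `μ_N`,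
`α` turns `a n k` into `k n a`; Tonelli reorders. (Gelbart (1975), Thm. 9.22 (iii): "`dg = da dn dk`".)
[cite: Gelbart1975, Thm. 9.22 (iii)] [cite: Folland1995, §2.6] -/
theorem exists_lintegral_eq_mul_lintegral_KNA :
    ∃ c : ℝ≥0, c ≠ 0 ∧ ∀ F : G → ℝ≥0∞, Measurable F →
      ∫⁻ g, F g ∂ν = c * ∫⁻ k, ∫⁻ n, ∫⁻ a, F ((k : G) * (n : G) * (a : G)) ∂α ∂μN ∂κ := by
  haveI : BorelSpace A := Subtype.borelSpace _
  haveI : BorelSpace N := Subtype.borelSpace _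
  haveI : BorelSpace B := Subtype.borelSpace _
  haveI : BorelSpace K := Subtype.borelSpace _
  haveI : SecondCountableTopology A := TopologicalSpace.Subtype.secondCountableTopology _
  haveI : SecondCountableTopology N := TopologicalSpace.Subtype.secondCountableTopology _
  haveI : SecondCountableTopology B := TopologicalSpace.Subtype.secondCountableTopology _
  haveI : SecondCountableTopology K := TopologicalSpace.Subtype.secondCountableTopology _
  haveI : BorelSpace (A × N) := Prod.borelSpace
  haveI : BorelSpace (B × K) := Prod.borelSpace
  haveI : BorelSpace ((A × N) × K) := Prod.borelSpace
  haveI : BorelSpace (N × K) := Prod.borelSpace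
  haveI : BorelSpace (K × (N × A)) := Prod.borelSpace
  haveI : CompactSpace K := isCompact_iff_compactSpace.1 hK
  haveI := isHaarMeasure_map_anMap B hAB hNB hAN α μN e he
  haveI : κ.IsInvInvariant := isInvInvariant_of_compactSpace κ
  set μB := Measure.map (anMap A N B hAB hNB) (α.prod μN) with hμB
  set c := HaarHK.decompConst hB hK (forall_exists_mem_mul_of_KB B hKB) ν μB κ with hc
  refine ⟨c, (HaarHK.decompConst_pos hB hK (forall_exists_mem_mul_of_KB B hKB) ν μB κ).ne', fun F hF => ?_⟩
  have hmAN : Measurable (anMap A N B hAB hNB) := (continuous_anMap A N B hAB hNB).measurable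
  have hmHK : Measurable (HaarHK.hkMap B K) := HaarHK.continuous_hkMap.measurable
  -- Step 1: `∫ F = ∫ F ∘ inv = c ∫_{B × K} F((b k⁻¹)⁻¹) = c ∫_B ∫_K F(k b⁻¹)`
  have hFi : Measurable fun g : G => F g⁻¹ := hF.comp measurable_inv
  have h1 : ∫⁻ g, F g ∂ν = ∫⁻ g, F g⁻¹ ∂ν := by
    conv_lhs => rw [← Measure.inv_eq_self ν]
    rw [Measure.inv, lintegral_map hF measurable_inv]
  have h2 : ∫⁻ g, F g⁻¹ ∂ν = c * ∫⁻ p, F ((p.2 : G) * ((p.1 : G))⁻¹) ∂(μB.prod κ) := by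
    rw [HaarHK.eq_smul_map_prod hB hK (forall_exists_mem_mul_of_KB B hKB) ν μB κ, lintegral_smul_measure,
      lintegral_map hFi hmHK]
    congr 1
    refine lintegral_congr fun p => ?_
    rw [HaarHK.hkMap_apply, mul_inv_rev, inv_inv]
  -- Step 2: coordinates on `B` and Tonelli
  have hF3 : Measurable fun q : (A × N) × K => F ((q.2 : G) * ((q.1.2 : G)⁻¹ * ((q.1.1 : G))⁻¹)) := by
    refine hF.comp ?_
    exact (continuous_subtype_val.comp continuous_snd).measurable.mul
      (((continuous_subtype_val.comp (continuous_snd.comp continuous_fst)).measurable.inv).mul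
        ((continuous_subtype_val.comp (continuous_fst.comp continuous_fst)).measurable.inv))
  have h3 : ∫⁻ p, F ((p.2 : G) * ((p.1 : G))⁻¹) ∂(μB.prod κ) =
      ∫⁻ q : (A × N) × K, F ((q.2 : G) * ((q.1.2 : G)⁻¹ * ((q.1.1 : G))⁻¹)) ∂((α.prod μN).prod κ) := by
    have hmeq : μB.prod κ = Measure.map (Prod.map (anMap A N B hAB hNB) id) ((α.prod μN).prod κ) := by
      rw [← Measure.map_prod_map _ _ hmAN measurable_id, Measure.map_id]
    have hg : Measurable fun p : B × K => F ((p.2 : G) * ((p.1 : G))⁻¹) :=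
      hF.comp ((continuous_subtype_val.comp continuous_snd).measurable.mul
        (continuous_subtype_val.comp continuous_fst).measurable.inv)
    rw [hmeq, lintegral_map hg (hmAN.prodMap measurable_id)]
    refine lintegral_congr fun q => ?_
    rcases q with ⟨⟨a, n⟩, k⟩
    change F ((k : G) * ((a : G) * (n : G))⁻¹) = _
    rw [mul_inv_rev]
  have h4 : ∫⁻ q : (A × N) × K, F ((q.2 : G) * ((q.1.2 : G)⁻¹ * ((q.1.1 : G))⁻¹)) ∂((α.prod μN).prod κ) =
      ∫⁻ a, ∫⁻ n, ∫⁻ k, F ((k : G) * ((n : G)⁻¹ * ((a : G))⁻¹)) ∂κ ∂μN ∂α := by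
    rw [lintegral_prod _ hF3.aemeasurable]
    have hF4 : Measurable fun q : A × N => ∫⁻ k, F ((k : G) * ((q.2 : G)⁻¹ * ((q.1 : G))⁻¹)) ∂κ :=
      hF3.lintegral_prod_right'
    rw [lintegral_prod _ hF4.aemeasurable]
  -- Step 3: inversion invariance of `μ_N` and `α`, then swap the order
  have h5 : ∀ a : A, ∫⁻ n, ∫⁻ k, F ((k : G) * ((n : G)⁻¹ * ((a : G))⁻¹)) ∂κ ∂μN =
      ∫⁻ n, ∫⁻ k, F ((k : G) * ((n : G) * ((a : G))⁻¹)) ∂κ ∂μN := fun a => by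
    have hmeas : Measurable fun n : N => ∫⁻ k, F ((k : G) * ((n : G) * ((a : G))⁻¹)) ∂κ := by
      refine Measurable.lintegral_prod_right' (f := fun q : N × K => F ((q.2 : G) * ((q.1 : G) * ((a : G))⁻¹))) ?_
      exact hF.comp ((continuous_subtype_val.comp continuous_snd).measurable.mul
        ((continuous_subtype_val.comp continuous_fst).measurable.mul measurable_const))
    conv_rhs => rw [← Measure.inv_eq_self μN]
    rw [Measure.inv, lintegral_map hmeas measurable_inv]
    rfl
  have h6 : ∫⁻ a, ∫⁻ n, ∫⁻ k, F ((k : G) * ((n : G) * ((a : G))⁻¹)) ∂κ ∂μN ∂α =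
      ∫⁻ a, ∫⁻ n, ∫⁻ k, F ((k : G) * ((n : G) * (a : G))) ∂κ ∂μN ∂α := by
    have hmeas : Measurable fun a : A => ∫⁻ n, ∫⁻ k, F ((k : G) * ((n : G) * (a : G))) ∂κ ∂μN := by
      refine Measurable.lintegral_prod_right' (f := fun q : A × N => ∫⁻ k, F ((k : G) * ((q.2 : G) * (q.1 : G))) ∂κ) ?_
      refine Measurable.lintegral_prod_right' (f := fun r : (A × N) × K => F ((r.2 : G) * ((r.1.2 : G) * (r.1.1 : G)))) ?_
      exact hF.comp ((continuous_subtype_val.comp continuous_snd).measurable.mul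
        ((continuous_subtype_val.comp (continuous_snd.comp continuous_fst)).measurable.mul
          (continuous_subtype_val.comp (continuous_fst.comp continuous_fst)).measurable))
    conv_rhs => rw [← Measure.inv_eq_self α]
    rw [Measure.inv, lintegral_map hmeas measurable_inv]
    rfl
  have hF7 : Measurable fun r : K × (N × A) => F ((r.1 : G) * ((r.2.1 : G) * (r.2.2 : G))) :=
    hF.comp ((continuous_subtype_val.comp continuous_fst).measurable.mul
      ((continuous_subtype_val.comp (continuous_fst.comp continuous_snd)).measurable.mul
        (continuous_subtype_val.comp (continuous_snd.comp continuous_snd)).measurable))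
  have h7 : ∫⁻ a, ∫⁻ n, ∫⁻ k, F ((k : G) * ((n : G) * (a : G))) ∂κ ∂μN ∂α =
      ∫⁻ k, ∫⁻ n, ∫⁻ a, F ((k : G) * (n : G) * (a : G)) ∂α ∂μN ∂κ := by
    -- `∫_A ∫_N ∫_K = ∫_{A × N} ∫_K = ∫_K ∫_{A × N} = ∫_K ∫_N ∫_A` (Tonelli)
    have e1 : ∫⁻ a, ∫⁻ n, ∫⁻ k, F ((k : G) * ((n : G) * (a : G))) ∂κ ∂μN ∂α =
        ∫⁻ q : A × N, ∫⁻ k, F ((k : G) * ((q.2 : G) * (q.1 : G))) ∂κ ∂(α.prod μN) := by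
      rw [lintegral_prod]
      exact (Measurable.lintegral_prod_right' (f := fun r : (A × N) × K =>
        F ((r.2 : G) * ((r.1.2 : G) * (r.1.1 : G)))) (hF.comp
          ((continuous_subtype_val.comp continuous_snd).measurable.mul
            ((continuous_subtype_val.comp (continuous_snd.comp continuous_fst)).measurable.mul
              (continuous_subtype_val.comp (continuous_fst.comp continuous_fst)).measurable)))).aemeasurable
    have e2 : ∫⁻ q : A × N, ∫⁻ k, F ((k : G) * ((q.2 : G) * (q.1 : G))) ∂κ ∂(α.prod μN) =
        ∫⁻ k, ∫⁻ q : A × N, F ((k : G) * ((q.2 : G) * (q.1 : G))) ∂(α.prod μN) ∂κ :=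
      lintegral_lintegral_swap ((hF.comp ((continuous_subtype_val.comp continuous_snd).measurable.mul
        ((continuous_subtype_val.comp (continuous_snd.comp continuous_fst)).measurable.mul
          (continuous_subtype_val.comp (continuous_fst.comp continuous_fst)).measurable))).aemeasurable)
    have e3 : ∀ k : K, ∫⁻ q : A × N, F ((k : G) * ((q.2 : G) * (q.1 : G))) ∂(α.prod μN) =
        ∫⁻ n, ∫⁻ a, F ((k : G) * (n : G) * (a : G)) ∂α ∂μN := fun k => by
      rw [lintegral_prod_symm]
      · refine lintegral_congr fun n => lintegral_congr fun a => ?_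
        rw [mul_assoc]
      · exact (hF.comp (measurable_const.mul ((continuous_subtype_val.comp continuous_snd).measurable.mul
          (continuous_subtype_val.comp continuous_fst).measurable))).aemeasurable
    rw [e1, e2]
    exact lintegral_congr e3
  rw [h1, h2, h3, h4]
  congr 1
  rw [lintegral_congr h5, h6, h7]

end KNA

/-! ### `∫_{G ⧸ A} u = C ∫_K ∫_N u(k n A)` and the vanishing principle -/

section Quotient

variable {G : Type u} [Group G] [TopologicalSpace G] [IsTopologicalGroup G] [LocallyCompactSpace G]
  [T2Space G] [SecondCountableTopology G] [MeasurableSpace G] [BorelSpace G]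
  {K A N B : Subgroup G} (hK : IsCompact (K : Set G)) (hA : IsClosed (A : Set G)) (hB : IsClosed (B : Set G))
  (hAB : A ≤ B) (hNB : N ≤ B) (hAN : ∀ a ∈ A, ∀ n ∈ N, a * n * a⁻¹ ∈ N)
  (e : A × N ≃ₜ B) (he : ∀ p, e p = anMap A N B hAB hNB p)
  (hKB : ∀ g : G, ∃ k ∈ K, ∃ b ∈ B, g = k * b)
  (ν : Measure G) [IsHaarMeasure ν] [ν.IsInvInvariant]
  (κ : Measure K) [IsHaarMeasure κ] [SFinite κ]
  (α : Measure A) [IsHaarMeasure α] [α.IsInvInvariant] [SFinite α]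
  (μN : Measure N) [IsHaarMeasure μN] [μN.IsInvInvariant] [SFinite μN]
  [MeasurableSpace (G ⧸ A)] [BorelSpace (G ⧸ A)]
  (μ : Measure (G ⧸ A)) [SMulInvariantMeasure G (G ⧸ A) μ] [IsFiniteMeasureOnCompacts μ]

include hK hA hB hAN e he hKB ν α in
/-- **Integration over `G ⧸ A` in the coordinates `k n`** (Gelbart (1975), Thm. 9.22 (iii) and
Remark 9.23: `∫_{A_v \ G_v} f(g⁻¹ μ g) dg = ∫_{N_v} ∫_{K_v} f(k⁻¹ n⁻¹ μ n k) dn dk`): for a non-zero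
`G`-invariant measure `μ` on `G ⧸ A` finite on compact sets there is one constant `C ≠ 0` with
`∫⁻_{G ⧸ A} u dμ = C ∫⁻_K ∫⁻_N u(k n A) dμ_N dκ` for every measurable `u : G ⧸ A → [0, ∞]`. Proof: with
a Bruhat function `β` of `A`, `∫_{G/A} u = c' ∫_G β (u ∘ π) dν` (`IsBruhatFunction.lintegral_eq_mul_lintegral`),
`= c' c ∫_K ∫_N ∫_A β(k n a) u(k n A) dα dμ_N dκ` (`exists_lintegral_eq_mul_lintegral_KNA`), and
`∫_A β(g a) dα(a) = 1`. [cite: Gelbart1975, Thm. 9.22 (iii)] [cite: Folland1995, §2.6 Thm. 2.49] -/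
theorem exists_lintegral_quotient_eq_mul_lintegral_lintegral (hμ : μ ≠ 0) :
    ∃ C : ℝ≥0, C ≠ 0 ∧ ∀ u : G ⧸ A → ℝ≥0∞, Measurable u →
      ∫⁻ x, u x ∂μ = C * ∫⁻ k, ∫⁻ n, u (QuotientGroup.mk ((k : G) * (n : G))) ∂μN ∂κ := by
  haveI : BorelSpace A := Subtype.borelSpace _
  haveI : BorelSpace N := Subtype.borelSpace _
  haveI : BorelSpace B := Subtype.borelSpace _
  haveI : BorelSpace K := Subtype.borelSpace _
  haveI : LocallyCompactSpace A := hA.locallyCompactSpace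
  haveI : SecondCountableTopology A := TopologicalSpace.Subtype.secondCountableTopology _
  haveI : SecondCountableTopology N := TopologicalSpace.Subtype.secondCountableTopology _
  haveI : SecondCountableTopology K := TopologicalSpace.Subtype.secondCountableTopology _
  haveI : BorelSpace (A × N) := Prod.borelSpace
  haveI : IsClosed (A : Set G) := hA
  -- a Bruhat function for `A`, and the two constants
  set β := bruhatFunction A α hA with hβdef
  have hβ : IsBruhatFunction A α β := isBruhatFunction_bruhatFunction A α hA
  have hα0 : α ≠ 0 := by
    intro h
    have hpos : 0 < α Set.univ := isOpen_univ.measure_pos α ⟨1, trivial⟩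
    rw [h] at hpos
    exact lt_irrefl _ hpos
  have hc' : unfoldingConstant A α μ ν ≠ 0 := (unfoldingConstant_pos A α μ ν hμ hα0).ne'
  obtain ⟨c, hc, hKNA⟩ := exists_lintegral_eq_mul_lintegral_KNA hK hB hAB hNB hAN e he hKB ν κ α μN
  refine ⟨unfoldingConstant A α μ ν * c, mul_ne_zero hc' hc, fun u hu => ?_⟩
  have hF : Measurable fun g : G => ENNReal.ofReal (β g) * u (QuotientGroup.mk g) :=
    hβ.continuous.measurable.ennreal_ofReal.mul (hu.comp (QuotientGroup.continuous_mk (N := A)).measurable)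
  rw [hβ.lintegral_eq_mul_lintegral A α μ ν hu, hKNA _ hF]
  have hinner : ∀ (k : K) (n : N),
      ∫⁻ a : A, ENNReal.ofReal (β ((k : G) * (n : G) * (a : G))) *
        u (QuotientGroup.mk ((k : G) * (n : G) * (a : G))) ∂α = u (QuotientGroup.mk ((k : G) * (n : G))) := by
    intro k n
    have h := hβ.fiberLIntegral_ofReal_mul_comp_mk A α u (QuotientGroup.mk ((k : G) * (n : G)))
    rwa [fiberLIntegral_mk] at h
  simp_rw [hinner]
  rw [ENNReal.coe_mul, mul_assoc]

include hK hA hB hAN e he hKB ν α in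
/-- **The measure form**: `μ = C • ((k, n) ↦ k n A)_* (κ ⊗ μ_N)` on `G ⧸ A`, `C ≠ 0`. [cite: Gelbart1975, Thm. 9.22 (iii)] -/
theorem exists_measure_quotient_eq_smul_map (hμ : μ ≠ 0) :
    ∃ C : ℝ≥0, C ≠ 0 ∧ μ = C • Measure.map
      (fun p : K × N => (QuotientGroup.mk ((p.1 : G) * (p.2 : G)) : G ⧸ A)) (κ.prod μN) := by
  haveI : BorelSpace N := Subtype.borelSpace _
  haveI : BorelSpace K := Subtype.borelSpace _
  haveI : SecondCountableTopology N := TopologicalSpace.Subtype.secondCountableTopology _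
  haveI : SecondCountableTopology K := TopologicalSpace.Subtype.secondCountableTopology _
  haveI : BorelSpace (K × N) := Prod.borelSpace
  obtain ⟨C, hC, h⟩ := exists_lintegral_quotient_eq_mul_lintegral_lintegral hK hA hB hAB hNB hAN e he hKB
    ν κ α μN μ hμ
  have hm : Measurable fun p : K × N => (QuotientGroup.mk ((p.1 : G) * (p.2 : G)) : G ⧸ A) :=
    ((QuotientGroup.continuous_mk (N := A)).comp ((continuous_subtype_val.comp continuous_fst).mul
      (continuous_subtype_val.comp continuous_snd))).measurable
  refine ⟨C, hC, Measure.ext fun S hS => ?_⟩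
  rw [Measure.smul_apply, Measure.map_apply hm hS, ← lintegral_indicator_one hS,
    h _ (measurable_one.indicator hS), ← lintegral_indicator_one (hS.preimage hm),
    lintegral_prod _ ((measurable_one.indicator (hS.preimage hm)).aemeasurable), ENNReal.smul_def, smul_eq_mul]
  rfl

omit [LocallyCompactSpace G] [T2Space G] [IsHaarMeasure κ] [IsHaarMeasure μN] [SFinite κ] [SFinite μN]
  [μN.IsInvInvariant] [SMulInvariantMeasure G (G ⧸ A) μ] [IsFiniteMeasureOnCompacts μ] in
/-- **Bochner form**: `∫_{G ⧸ A} φ dμ = C ∫_{K × N} φ(k n A) d(κ ⊗ μ_N)` for every strongly measurable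
Banach-valued `φ`, once `μ = C • ((k, n) ↦ k n A)_* (κ ⊗ μ_N)` (no integrability needed). [folklore] -/
theorem integral_quotient_eq_smul_integral_prod {E : Type*} [NormedAddCommGroup E] [NormedSpace ℝ E]
    {C : ℝ≥0} (hμC : μ = C • Measure.map
      (fun p : K × N => (QuotientGroup.mk ((p.1 : G) * (p.2 : G)) : G ⧸ A)) (κ.prod μN))
    (φ : G ⧸ A → E) (hφ : StronglyMeasurable φ) :
    ∫ x, φ x ∂μ = C • ∫ p : K × N, φ (QuotientGroup.mk ((p.1 : G) * (p.2 : G))) ∂(κ.prod μN) := by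
  haveI : BorelSpace N := Subtype.borelSpace _
  haveI : BorelSpace K := Subtype.borelSpace _
  haveI : SecondCountableTopology N := TopologicalSpace.Subtype.secondCountableTopology _
  haveI : SecondCountableTopology K := TopologicalSpace.Subtype.secondCountableTopology _
  haveI : BorelSpace (K × N) := Prod.borelSpace
  have hm : Measurable fun p : K × N => (QuotientGroup.mk ((p.1 : G) * (p.2 : G)) : G ⧸ A) :=
    ((QuotientGroup.continuous_mk (N := A)).comp ((continuous_subtype_val.comp continuous_fst).mul
      (continuous_subtype_val.comp continuous_snd))).measurable
  rw [hμC, integral_smul_nnreal_measure, integral_map hm.aemeasurable hφ.aestronglyMeasurable]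

omit [LocallyCompactSpace G] [T2Space G] [IsHaarMeasure κ] [IsHaarMeasure μN]
  [μN.IsInvInvariant] [SMulInvariantMeasure G (G ⧸ A) μ] [IsFiniteMeasureOnCompacts μ] in
/-- **The vanishing principle** (the shape of Gelbart's "`F^A_{f_v}(μ) = 0`", Remark 9.23, and of
(10.22)): if `μ = C • ((k, n) ↦ k n A)_* (κ ⊗ μ_N)` and the `N`-integrals `∫_N φ(k n A) dμ_N(n)` vanish
for every `k ∈ K`, then `∫_{G ⧸ A} φ dμ = 0` — by Fubini when `(k, n) ↦ φ(k n A)` is integrable on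
`K × N`, and because non-integrable functions have integral `0` otherwise. [cite: Gelbart1975, Remark 9.23 p. 140] -/
theorem integral_quotient_eq_zero_of_forall_integral_eq_zero {E : Type*} [NormedAddCommGroup E]
    [NormedSpace ℝ E] {C : ℝ≥0} (hμC : μ = C • Measure.map
      (fun p : K × N => (QuotientGroup.mk ((p.1 : G) * (p.2 : G)) : G ⧸ A)) (κ.prod μN))
    (φ : G ⧸ A → E) (hφ : StronglyMeasurable φ)
    (h0 : ∀ k : K, ∫ n : N, φ (QuotientGroup.mk ((k : G) * (n : G))) ∂μN = 0) :
    ∫ x, φ x ∂μ = 0 := by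
  rw [integral_quotient_eq_smul_integral_prod κ μN μ hμC φ hφ]
  by_cases hint : Integrable (fun p : K × N => φ (QuotientGroup.mk ((p.1 : G) * (p.2 : G)))) (κ.prod μN)
  · rw [integral_prod _ hint]
    simp only [h0, integral_zero, smul_zero]
  · rw [integral_undef hint, smul_zero]

end Quotient

end Literature.NumberTheory.Automorphic
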